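import Summits.HodgeConjecture.HodgeConjecture.Theorems.MarkmanPartnerTransportPicardThreeK3SquaresKugaSatakeSimilarTransport
import Literature.AlgebraicGeometry.Surfaces.KugaSatakeVarietyBettiExistence
import Literature.AlgebraicGeometry.Motives.KugaSatakePolarizationProofs
import Literature.AlgebraicGeometry.Motives.KugaSatakeEmbedding
import Literature.AlgebraicGeometry.Motives.WeilTypePolarization
import Literature.AlgebraicGeometry.Motives.AbelianVarietyProjectiveChart
import Literature.AlgebraicGeometry.HodgeTheory.BettiUniverseKunnethHodge
import Mathlib.LinearAlgebra.Contraction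
import Mathlib.LinearAlgebra.TensorProduct.RightExactness
import Mathlib.Algebra.Module.Projective

/-!
# Route MarkmanPartnerTransport · crux `PicardThreeK3Squares` (stmt-HodgeConjecture-19652) —
# instantiating the Kuga–Satake predicate TWICE: the two algebraic correspondences of a self-similitude

Programme «KS-SELF», step 2c. The Kuga–Satake predicate `HodgeTheory.IsKSCorrespondenceAlgebraicBetti hS`
of a smooth projective surface `S` quantifies over presentations `(T, H, P, ε, j)` of the transcendental
part, orthogonal negative pairs `e₁, e₂`, van Geemen's tensor inclusions `κ_C` and Kuga–Satake
varieties `(A, B, θ)`, and returns an algebraic correspondence `O : H²(S) → H²(A × A)` restricting on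
`j(T)` to the Kuga–Satake class map `μ' = κ_{A} ∘ (θ⁻¹ ⊗ θ⁻¹) ∘ κ_C`. This file supplies the auxiliary
data and instantiates the predicate at TWO presentations sharing `(T, H)` and the abelian variety `A`:

* `exists_isTensorEmbedding` — **van Geemen's tensor inclusion EXISTS** for `(E_{e₁e₂}, e₁)`: the trace
  form `E_{e₁e₂}` is `±` a polarization of the Kuga–Satake structure (the tree's theorem
  `kugaSatake_exists_polarization_traceForm_holds`), hence non-degenerate, so
  `C⁺ ⊗ C⁺ → End(C⁺)`, `z ↦ (E♭ ⊗ 1) z`, is surjective and the sandwich embedding `M_v` lifts;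
* `kugaSatakeClassMapBetti_injective` — `μ'` is injective (`κ_C` injective as `M_v` is, `θ` bijective,
  and the cross product `H¹(A) ⊗ H¹(A) → H²(A × A)` injective by the tree's Künneth theorem
  `BettiUniverse.kunnethMap_bijective`);
* `kugaSatakeClassMapBetti_transport` — for the rescaled polarization `d · P` and the `φ`-transported
  data `θ' = φ ∘ θ`, `κ' = (φ ⊗ φ) ∘ κ_C` (`φ : C⁺(Q) ⥲ C⁺(dQ)`, file `…KugaSatakeSimilarTransport`),
  **the Kuga–Satake class map is unchanged**: `μ'_{d·P, θ', κ'} = μ'_{P, θ, κ}`;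
* `exists_two_correspondences_of_kugaSatake` — **THE TWO CORRESPONDENCES**: granted the Kuga–Satake
  predicate for `S`, for a presentation `(T, H, P, ε, j)` and a `P`-self-adjoint `g : Hom H H` with
  `g² = d > 0`, there are an abelian variety `A`, an injective `μ : T → H²((A × A)(ℂ); ℚ)` and ALGEBRAIC
  correspondences `O₁, O₂ : H²(S(ℂ); ℂ) → H²((A × A)(ℂ); ℂ)` with `O₁(j t ⊗ 1) = μ t ⊗ 1` and
  `O₂(j(g t) ⊗ 1) = μ t ⊗ 1` — i.e. `O₂ ∘ g = O₁` on `T`.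

THEOREMS ONLY; no definition, no named fact, no sorry; the Kuga–Satake statement is a HYPOTHESIS;
credits nothing to the Hodge conjecture. Prover seat hodge-nonav-19652-p1 (gen 14),
`--supports stmt-HodgeConjecture-19652`.

References: B. van Geemen, *Kuga-Satake varieties and the Hodge conjecture* (2000), §5.9, §6.3, §8.3,
§10.2; M. Varesco, Math. Z. 305 (2023), Prop. 3.1 and §4; S. Floccari, Geom. Topol. 30 (2026), §3.3
Rem. 3.4; C. Voisin, *Hodge Theory I*, Thm. 11.38 (Künneth).
-/

set_option linter.dupNamespace false

noncomputable section

namespace Summit.HodgeConjecture.HodgeConjecture.Theorems.MarkmanPartnerTransport.KugaSatakeSelf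

open scoped TensorProduct
open CategoryTheory MonoidalCategory Literature.AlgebraicGeometry Literature.AlgebraicGeometry.Motives
open Literature.AlgebraicGeometry.HodgeTheory Literature.AlgebraicTopology.SingularHomology
open Literature.AlgebraicGeometry.Motives.HodgeStructure Literature.AlgebraicGeometry.Motives.HodgeStructure.KugaSatake
open Literature.AlgebraicGeometry.Surfaces

/-! ### §1 van Geemen's tensor inclusion exists -/

section TensorEmbedding

variable {T : Type} [AddCommGroup T] [Module ℚ T] [Module.Finite ℚ T] {H : HodgeStructure T 2}
  (P : H.Polarization)

/-- **van Geemen's trace form `E_{e₁e₂}` is non-degenerate** for an orthogonal pair with `P(eᵢ, eᵢ) < 0`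
(it is `±` a polarization of the Kuga–Satake Hodge structure, `kugaSatake_exists_polarization_traceForm_holds`).
[cite: vanGeemen2000KugaSatakeHC, Prop. 5.9] -/
theorem traceForm_nondegenerate (hK3 : H.IsOfK3Type) {e₁ e₂ : T} (h12 : P.form e₁ e₂ = 0)
    (h1 : P.form e₁ e₁ < 0) (h2 : P.form e₂ e₂ < 0) :
    (traceForm P.quadraticForm ((CliffordAlgebra.even.ι P.quadraticForm).bilin e₁ e₂)).Nondegenerate := by
  obtain ⟨ε, PK, hPK⟩ := kugaSatake_exists_polarization_traceForm_holds H P hK3 e₁ e₂ h12 h1 h2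
  set E := traceForm P.quadraticForm ((CliffordAlgebra.even.ι P.quadraticForm).bilin e₁ e₂) with hE
  have hεE : E = ((ε : ℤ) : ℚ) • PK.form := by
    rw [hPK, smul_smul, ← Int.cast_mul, ← Units.val_mul, Int.units_mul_self, Units.val_one, Int.cast_one,
      one_smul]
  have hnd := PK.nondegenerate
  have hε0 : ((ε : ℤ) : ℚ) ≠ 0 := by exact_mod_cast Units.ne_zero ε
  refine ⟨fun x hx => hnd.1 x fun y => ?_, fun y hy => hnd.2 y fun x => ?_⟩
  · have h := hx y
    rw [hεE, LinearMap.smul_apply, LinearMap.smul_apply, smul_eq_mul] at h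
    exact (mul_eq_zero.1 h).resolve_left hε0
  · have h := hy x
    rw [hεE, LinearMap.smul_apply, LinearMap.smul_apply, smul_eq_mul] at h
    exact (mul_eq_zero.1 h).resolve_left hε0

/-- **van Geemen's tensor inclusion `κ_C : T ↪ C⁺(Q) ⊗ C⁺(Q)` exists** for `(E_{e₁e₂}, e₁)`
(`KugaSatake.IsTensorEmbedding`): `E_{e₁e₂}` is non-degenerate on the finite-dimensional `C⁺(Q)`, so
`z ↦ [(E♭ ⊗ 1) z] : C⁺ ⊗ C⁺ → End(C⁺)` is surjective (`dualTensorHomEquivOfBasis`) and admits a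
linear section through which `v ↦ M_v = [x ↦ v x e₁]` factors. [cite: vanGeemen2000KugaSatakeHC, §6.3 and Prop. 5.9] -/
theorem exists_isTensorEmbedding (hK3 : H.IsOfK3Type) {e₁ e₂ : T} (h12 : P.form e₁ e₂ = 0)
    (h1 : P.form e₁ e₁ < 0) (h2 : P.form e₂ e₂ < 0) :
    ∃ κ : T →ₗ[ℚ] CliffordAlgebra.even P.quadraticForm ⊗[ℚ] CliffordAlgebra.even P.quadraticForm,
      IsTensorEmbedding P.quadraticForm
        (traceForm P.quadraticForm ((CliffordAlgebra.even.ι P.quadraticForm).bilin e₁ e₂)) e₁ κ := by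
  classical
  haveI : Invertible (2 : ℚ) := invertibleOfNonzero two_ne_zero
  set q := P.quadraticForm with hq
  set C := CliffordAlgebra.even q with hC
  set E := traceForm q ((CliffordAlgebra.even.ι q).bilin e₁ e₂) with hE
  have hnd : E.Nondegenerate := traceForm_nondegenerate P hK3 h12 h1 h2
  -- `Φ : C ⊗ C → End C`, `z ↦ [(E♭ ⊗ 1) z]`, is surjective
  set Φ : C ⊗[ℚ] C →ₗ[ℚ] Module.End ℚ C :=
    dualTensorHom ℚ C C ∘ₗ TensorProduct.map E LinearMap.id with hΦ
  have hEsurj : Function.Surjective (E : C →ₗ[ℚ] Module.Dual ℚ C) := by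
    intro f
    refine ⟨(LinearMap.BilinForm.toDual E hnd).symm f, ?_⟩
    have h : (E : C →ₗ[ℚ] Module.Dual ℚ C) ((LinearMap.BilinForm.toDual E hnd).symm f) =
        LinearMap.BilinForm.toDual E hnd ((LinearMap.BilinForm.toDual E hnd).symm f) := rfl
    rw [h, LinearEquiv.apply_symm_apply]
  have hΦsurj : Function.Surjective Φ := by
    intro f
    obtain ⟨z, hz⟩ := (dualTensorHomEquivOfBasis (N := C) (Module.finBasis ℚ C)).surjective f
    obtain ⟨w, hw⟩ := TensorProduct.map_surjective hEsurj
      ((fun x => ⟨x, rfl⟩) : Function.Surjective (LinearMap.id : C →ₗ[ℚ] C)) z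
    refine ⟨w, ?_⟩
    rw [hΦ, LinearMap.comp_apply, hw, ← dualTensorHomEquivOfBasis_apply (Module.finBasis ℚ C), hz]
  obtain ⟨s, hs⟩ := Φ.exists_rightInverse_of_surjective (LinearMap.range_eq_top.2 hΦsurj)
  refine ⟨s ∘ₗ embedding q e₁, fun v => ?_⟩
  have h := LinearMap.congr_fun hs (embedding q e₁ v)
  rw [LinearMap.comp_apply, LinearMap.id_apply, hΦ, LinearMap.comp_apply] at h
  rw [LinearMap.comp_apply]
  exact h

omit [Module.Finite ℚ T] in
/-- A tensor inclusion is injective (`M_v` is injective in `v` for `Q(e₁) ≠ 0`, `embedding_injective`).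
[cite: vanGeemen2000KugaSatakeHC, §6.3] -/
theorem isTensorEmbedding_injective {E : LinearMap.BilinForm ℚ (CliffordAlgebra.even P.quadraticForm)}
    {e₁ : T} (h1 : P.form e₁ e₁ ≠ 0)
    {κ : T →ₗ[ℚ] CliffordAlgebra.even P.quadraticForm ⊗[ℚ] CliffordAlgebra.even P.quadraticForm}
    (hκ : IsTensorEmbedding P.quadraticForm E e₁ κ) : Function.Injective κ := by
  haveI : Invertible (2 : ℚ) := invertibleOfNonzero two_ne_zero
  have hunit : IsUnit (P.quadraticForm e₁) := by
    rw [Polarization.quadraticForm_apply, isUnit_iff_ne_zero]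
    exact h1
  have hinj := embedding_injective P.quadraticForm hunit
  intro v w hvw
  exact hinj (by rw [← hκ v, ← hκ w, hvw])

end TensorEmbedding

/-! ### §2 Injectivity of the Kuga–Satake class map -/

/-- The external cup product `H¹(A) ⊗ H¹(A) → H²(A × A)` is the tree's cross product in bidegree `(1,1)`.
[cite: VoisinHodgeI2002, §11.3.3 Thm. 11.38] -/
theorem lift_externalCupOneOne_eq_crossMap (A : SchemeOver ℂ) :
    TensorProduct.lift (externalCupOneOne A) = BettiUniverse.crossMap A A (rfl : 1 + 1 = 2) :=
  TensorProduct.ext' fun a b => by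
    rw [TensorProduct.lift.tmul, BettiUniverse.crossMap_tmul, externalCupOneOne_apply]

/-- **The cross product `H¹(A) ⊗ H¹(A) → H²(A × A)` is injective** for a smooth projective `A` (the
tree's Künneth isomorphism `BettiUniverse.kunnethMap_bijective`, restricted to the summand `(1,1)`).
[cite: VoisinHodgeI2002, §11.3.3 Thm. 11.38] -/
theorem lift_externalCupOneOne_injective {m : ℕ} {A : SchemeOver ℂ} (hA : IsSmoothProjective m A) :
    Function.Injective (TensorProduct.lift (externalCupOneOne A)) := by
  classical
  rw [lift_externalCupOneOne_eq_crossMap]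
  let ij : ↥(Finset.HasAntidiagonal.antidiagonal (2 : ℕ)) :=
    ⟨(1, 1), Finset.HasAntidiagonal.mem_antidiagonal.2 rfl⟩
  intro x y hxy
  have h := (BettiUniverse.kunnethMap_bijective hA hA 2).1
    (a₁ := Pi.single ij x) (a₂ := Pi.single ij y)
    (by rw [BettiUniverse.kunnethMap_single, BettiUniverse.kunnethMap_single]; exact hxy)
  have h' := congrFun h ij
  rwa [Pi.single_eq_same, Pi.single_eq_same] at h'

/-- **The Kuga–Satake class map `μ' : T → H²((A × A)(ℂ); ℚ)` is injective** (`κ_C` injective,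
`θ⁻¹ ⊗ θ⁻¹` bijective, cross product injective). [cite: vanGeemen2000KugaSatakeHC, §6.3, §8.3 and Lemma 10.3] -/
theorem kugaSatakeClassMapBetti_injective {T : Type} [AddCommGroup T] [Module ℚ T] {H : HodgeStructure T 2}
    (P : H.Polarization) (A : AbelianVariety ℂ)
    (θ : bettiCohomology A.X 1 ≃ₗ[ℚ] CliffordAlgebra.even P.quadraticForm)
    {κ : T →ₗ[ℚ] CliffordAlgebra.even P.quadraticForm ⊗[ℚ] CliffordAlgebra.even P.quadraticForm}
    (hκ : Function.Injective κ) : Function.Injective (kugaSatakeClassMapBetti H P θ κ) := by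
  have hA : IsSmoothProjective A.dim A.X := AbelianVariety.isSmoothProjective_holds
  have h1 := lift_externalCupOneOne_injective hA
  have h2 : Function.Injective (TensorProduct.map θ.symm.toLinearMap θ.symm.toLinearMap) :=
    (TensorProduct.congr θ.symm θ.symm).injective
  exact (h1.comp h2).comp hκ

/-! ### §3 The transported Kuga–Satake data of the rescaled polarization -/

section Transport

variable {T : Type} [AddCommGroup T] [Module ℚ T] {H : HodgeStructure T 2} (P : H.Polarization)
  {d : ℚ} (hd : 0 < d)

/-- The identity is a similarity `(T, Q) → (T, dQ)` of multiplier `d` for the rescaled polarization. [folklore] -/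
theorem quadraticForm_smul_refl (v : T) :
    (P.smul d hd).quadraticForm (LinearEquiv.refl ℚ T v) =
      ((Units.mk0 d hd.ne' : ℚˣ) : ℚ) * P.quadraticForm v := by
  rw [LinearEquiv.refl_apply, Polarization.quadraticForm_apply, Polarization.quadraticForm_apply,
    Polarization.smul_form_apply, Units.val_mk0]

/-- The transported orthogonal pair `(d⁻¹ e₁, e₂)` is orthogonal with negative squares for `d · P`. [folklore] -/
theorem smul_pair_conditions {e₁ e₂ : T} (h12 : P.form e₁ e₂ = 0) (h1 : P.form e₁ e₁ < 0)
    (h2 : P.form e₂ e₂ < 0) :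
    (P.smul d hd).form (d⁻¹ • e₁) e₂ = 0 ∧ (P.smul d hd).form (d⁻¹ • e₁) (d⁻¹ • e₁) < 0 ∧
      (P.smul d hd).form e₂ e₂ < 0 := by
  have hd0 : d ≠ 0 := hd.ne'
  refine ⟨?_, ?_, ?_⟩
  · rw [Polarization.smul_form_apply, LinearMap.map_smul₂, smul_eq_mul, h12, mul_zero, mul_zero]
  · rw [Polarization.smul_form_apply, LinearMap.map_smul₂, map_smul, smul_eq_mul, smul_eq_mul]
    have : d * (d⁻¹ * (d⁻¹ * P.form e₁ e₁)) = d⁻¹ * P.form e₁ e₁ := by field_simp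
    rw [this]
    exact mul_neg_of_pos_of_neg (inv_pos.2 hd) h1
  · rw [Polarization.smul_form_apply]
    exact mul_neg_of_pos_of_neg hd h2

/-- **The Kuga–Satake class map is unchanged under the transport**: with `φ : C⁺(Q) ⥲ C⁺(dQ)` the
isomorphism of the identity similarity, `θ' = φ ∘ θ` and `κ' = (φ ⊗ φ) ∘ κ ∘ id⁻¹`,
`μ'_{d·P, θ', κ'} = μ'_{P, θ, κ}` (`(θ'⁻¹ ⊗ θ'⁻¹)(φ ⊗ φ) = θ⁻¹ ⊗ θ⁻¹`). [cite: Varesco2023, Prop. 3.1]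
[cite: vanGeemen2000KugaSatakeHC, §8.3] -/
theorem kugaSatakeClassMapBetti_transport {A : SchemeOver ℂ}
    (θ : bettiCohomology A 1 ≃ₗ[ℚ] CliffordAlgebra.even P.quadraticForm)
    (κ : T →ₗ[ℚ] CliffordAlgebra.even P.quadraticForm ⊗[ℚ] CliffordAlgebra.even P.quadraticForm) (t : T) :
    kugaSatakeClassMapBetti H (P.smul d hd)
        (θ.trans (evenEquivOfSimilar P.quadraticForm (P.smul d hd).quadraticForm (LinearEquiv.refl ℚ T)
          (Units.mk0 d hd.ne') (quadraticForm_smul_refl P hd)).toLinearEquiv)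
        (TensorProduct.map
            (evenEquivOfSimilar P.quadraticForm (P.smul d hd).quadraticForm (LinearEquiv.refl ℚ T)
              (Units.mk0 d hd.ne') (quadraticForm_smul_refl P hd)).toLinearEquiv.toLinearMap
            (evenEquivOfSimilar P.quadraticForm (P.smul d hd).quadraticForm (LinearEquiv.refl ℚ T)
              (Units.mk0 d hd.ne') (quadraticForm_smul_refl P hd)).toLinearEquiv.toLinearMap ∘ₗ
          κ ∘ₗ (LinearEquiv.refl ℚ T).symm.toLinearMap) t =
      kugaSatakeClassMapBetti H P θ κ t := by
  set φ := evenEquivOfSimilar P.quadraticForm (P.smul d hd).quadraticForm (LinearEquiv.refl ℚ T)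
    (Units.mk0 d hd.ne') (quadraticForm_smul_refl P hd) with hφ
  simp only [kugaSatakeClassMapBetti, LinearMap.comp_apply, LinearEquiv.coe_toLinearMap,
    LinearEquiv.refl_symm, LinearEquiv.refl_apply]
  congr 1
  induction κ t using TensorProduct.induction_on with
  | zero => rw [map_zero, map_zero, map_zero]
  | tmul a b =>
    rw [TensorProduct.map_tmul, TensorProduct.map_tmul, TensorProduct.map_tmul]
    simp only [LinearEquiv.coe_toLinearMap, LinearEquiv.symm_trans_apply]
    congr 1 <;> exact congrArg θ.symm (φ.toLinearEquiv.symm_apply_apply _)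
  | add x y hx hy => rw [map_add, map_add, map_add, hx, hy]

/-- **The transported Kuga–Satake variety**: a Kuga–Satake variety `(A, B, θ)` of `(T, H, P)` is a
Kuga–Satake variety of `(T, H, d·P)` through `θ' = φ ∘ θ` (the Kuga–Satake filtration transports under
`φ`, `map_kugaSatake_F_evenEquivOfSimilar`). [cite: Varesco2023, Lemma 3.3 and Prop. 3.1] -/
theorem isKugaSatakeVarietyBetti_transport (hT : H.hodgeNumber 2 0 = 1) {A : AbelianVariety ℂ}
    {B : HodgeModel A.dim A.X} {hB : B.IsHodgeSymmetric}
    {θ : bettiCohomology A.X 1 ≃ₗ[ℚ] CliffordAlgebra.even P.quadraticForm}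
    (hθ : IsKugaSatakeVarietyBetti H P hT A B hB θ) :
    IsKugaSatakeVarietyBetti H (P.smul d hd) hT A B hB
      (θ.trans (evenEquivOfSimilar P.quadraticForm (P.smul d hd).quadraticForm (LinearEquiv.refl ℚ T)
        (Units.mk0 d hd.ne') (quadraticForm_smul_refl P hd)).toLinearEquiv) := by
  intro p
  set φ := evenEquivOfSimilar P.quadraticForm (P.smul d hd).quadraticForm (LinearEquiv.refl ℚ T)
    (Units.mk0 d hd.ne') (quadraticForm_smul_refl P hd) with hφ
  have hco : ((θ.trans φ.toLinearEquiv : bettiCohomology A.X 1 ≃ₗ[ℚ] _) : bettiCohomology A.X 1 →ₗ[ℚ] _) =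
      φ.toLinearEquiv.toLinearMap ∘ₗ θ.toLinearMap := rfl
  rw [hco, LinearMap.baseChange_comp, Submodule.map_comp, hθ p]
  exact map_kugaSatake_F_evenEquivOfSimilar P (P.smul d hd) hT (Units.mk0 d hd.ne') (quadraticForm_smul_refl P hd) p

/-- **The transported tensor inclusion** for `d · P`: `κ' = (φ ⊗ φ) ∘ κ` is van Geemen's inclusion for
the pair `(d⁻¹ e₁, e₂)` (`isTensorEmbedding_evenEquivOfSimilar` with `(d⁻¹ e₁)(e₂) = φ(e₁ e₂)`).
[cite: vanGeemen2000KugaSatakeHC, §6.3 and Prop. 5.9] -/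
theorem isTensorEmbedding_transport {e₁ e₂ : T}
    {κ : T →ₗ[ℚ] CliffordAlgebra.even P.quadraticForm ⊗[ℚ] CliffordAlgebra.even P.quadraticForm}
    (hκ : IsTensorEmbedding P.quadraticForm
      (traceForm P.quadraticForm ((CliffordAlgebra.even.ι P.quadraticForm).bilin e₁ e₂)) e₁ κ) :
    IsTensorEmbedding (P.smul d hd).quadraticForm
      (traceForm (P.smul d hd).quadraticForm
        ((CliffordAlgebra.even.ι (P.smul d hd).quadraticForm).bilin (d⁻¹ • e₁) e₂)) (d⁻¹ • e₁)
      (TensorProduct.map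
          (evenEquivOfSimilar P.quadraticForm (P.smul d hd).quadraticForm (LinearEquiv.refl ℚ T)
            (Units.mk0 d hd.ne') (quadraticForm_smul_refl P hd)).toLinearEquiv.toLinearMap
          (evenEquivOfSimilar P.quadraticForm (P.smul d hd).quadraticForm (LinearEquiv.refl ℚ T)
            (Units.mk0 d hd.ne') (quadraticForm_smul_refl P hd)).toLinearEquiv.toLinearMap ∘ₗ
        κ ∘ₗ (LinearEquiv.refl ℚ T).symm.toLinearMap) := by
  have hinv : ((Units.mk0 d hd.ne')⁻¹ : ℚˣ) = Units.mk0 d⁻¹ (inv_ne_zero hd.ne') := by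
    ext; simp
  have h := isTensorEmbedding_evenEquivOfSimilar P.quadraticForm (P.smul d hd).quadraticForm
    (LinearEquiv.refl ℚ T) (Units.mk0 d hd.ne') (quadraticForm_smul_refl P hd)
    ((CliffordAlgebra.even.ι P.quadraticForm).bilin e₁ e₂) e₁ hκ
  have he : (((Units.mk0 d hd.ne')⁻¹ : ℚˣ) : ℚ) • (LinearEquiv.refl ℚ T) e₁ = d⁻¹ • e₁ := by
    rw [hinv, Units.val_mk0, LinearEquiv.refl_apply]
  rw [he, ← ι_bilin_smul_eq_evenEquivOfSimilar] at h
  rw [hinv, Units.val_mk0, LinearEquiv.refl_apply, LinearEquiv.refl_apply] at h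
  exact h

end Transport

/-! ### §4 The two correspondences -/

/-- **THE TWO ALGEBRAIC CORRESPONDENCES OF A SELF-SIMILITUDE, GRANTED KUGA–SATAKE.** Let `S` be a smooth
projective surface whose Kuga–Satake correspondence is algebraic (`IsKSCorrespondenceAlgebraicBetti`,
HYPOTHESIS), `(T, H, P, ε, j)` a presentation of its transcendental part with `H` of K3 type, and
`g : Hom H H` a `P`-self-adjoint endomorphism (read through `j` and `∫_S`) with `g² = d`, `d > 0`. Then
for some complex abelian variety `A` (a Kuga–Satake variety of `(T, H, P)`), some INJECTIVE
`μ : T → H²((A × A)(ℂ); ℚ)` (the Kuga–Satake class map) and two maps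
`O₁, O₂ : H²(S(ℂ); ℂ) → H²((A × A)(ℂ); ℂ)` INDUCED BY ALGEBRAIC CYCLES on `(A × A) × S`:
`O₁(j t ⊗ 1) = μ t ⊗ 1` and `O₂(j (g t) ⊗ 1) = μ t ⊗ 1` for all `t ∈ T` — the predicate instantiated at
`(T, H, P, ε, j; e₁, e₂, κ_C; A, B, θ)` and at `(T, H, d·P, ε, j ∘ g; d⁻¹e₁, e₂, (φ ⊗ φ)κ_C; A, B, φθ)`,
whose Kuga–Satake class maps coincide. [cite: Varesco2023, §4 (proof of Thm. 4.5) and Prop. 3.1]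
[cite: Floccari2026, §3.3 Rem. 3.4] [cite: vanGeemen2000KugaSatakeHC, §10.2] -/
theorem exists_two_correspondences_of_kugaSatake {S : SchemeOver ℂ} (hS : IsSmoothProjective 2 S)
    (hKS : IsKSCorrespondenceAlgebraicBetti hS) {M : HodgeModel 2 S} {hM : M.IsHodgeSymmetric}
    {T : Type} [AddCommGroup T] [Module ℚ T] {H : HodgeStructure T 2} {P : H.Polarization} {ε : ℤˣ}
    {j : H.Hom (bettiTwoHodgeStructure hS M hM)} (hj : IsTranscendentalPartBetti hS M hM H P ε j)
    (hK3 : H.IsOfK3Type) (g : Hom H H) {d : ℚ} (hd : 0 < d)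
    (hjg : IsTranscendentalPartBetti hS M hM H (P.smul d hd) ε (j.comp g)) :
    ∃ (A : AbelianVariety ℂ) (μ : T →ₗ[ℚ] bettiCohomology (A.X ⊗ A.X) 2)
      (O₁ O₂ : complexBetti S (2 * 1) →ₗ[ℂ] complexBetti (A.X ⊗ A.X) 2),
      Function.Injective μ ∧
      IsAlgebraicCorrespondence (A.dim + A.dim) 2 (A.X ⊗ A.X) S O₁ ∧
      IsAlgebraicCorrespondence (A.dim + A.dim) 2 (A.X ⊗ A.X) S O₂ ∧
      (∀ t : T, O₁ (ofRatClass (Motives.ComplexPoints S) (2 * 1) (j.toLinearMap t)) =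
        ofRatClass (Motives.ComplexPoints (A.X ⊗ A.X)) 2 (μ t)) ∧
      (∀ t : T, O₂ (ofRatClass (Motives.ComplexPoints S) (2 * 1) (j.toLinearMap (g.toLinearMap t))) =
        ofRatClass (Motives.ComplexPoints (A.X ⊗ A.X)) 2 (μ t)) := by
  haveI : Module.Finite ℚ T := finite_of_isTranscendentalPartBetti hj
  have hT : H.hodgeNumber 2 0 = 1 := hK3.1
  -- van Geemen's data for `(T, H, P)`
  obtain ⟨e₁, e₂, h12, h1, h2⟩ := P.exists_orthogonal_pair_form_self_neg H hK3
  obtain ⟨κ, hκ⟩ := exists_isTensorEmbedding P hK3 h12 h1 h2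
  obtain ⟨A, B, hB, θ, hθ⟩ := exists_isKugaSatakeVarietyBetti_of_isTranscendentalPartBetti' hj hT
  -- first instantiation
  obtain ⟨O₁, hO₁, hO₁j⟩ := hKS M hM T H P hT ε j hj e₁ e₂ h12 h1 h2 κ hκ A B hB θ hθ
  -- second instantiation, at the transported data
  obtain ⟨h12', h1', h2'⟩ := smul_pair_conditions P hd h12 h1 h2
  obtain ⟨O₂, hO₂, hO₂j⟩ := hKS M hM T H (P.smul d hd) hT ε (j.comp g) hjg (d⁻¹ • e₁) e₂ h12' h1' h2' _
    (isTensorEmbedding_transport P hd hκ) A B hB _ (isKugaSatakeVarietyBetti_transport P hd hT hθ)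
  refine ⟨A, kugaSatakeClassMapBetti H P θ κ, O₁, O₂,
    kugaSatakeClassMapBetti_injective P A θ (isTensorEmbedding_injective P h1.ne hκ), hO₁, hO₂, hO₁j,
    fun t => ?_⟩
  rw [← kugaSatakeClassMapBetti_transport P hd θ κ t]
  exact hO₂j t

end Summit.HodgeConjecture.HodgeConjecture.Theorems.MarkmanPartnerTransport.KugaSatakeSelf

end
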